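import Literature.NumberTheory.Transcendental.NesterenkoElimination
import HarnessLib

/-!
# Coefficient estimates for Nesterenko's `ϰ(F)` (LNM 1752 Ch. 3 §4) — the `ℓ¹`-norm toolkit

Topic `Literature/NumberTheory/Transcendental`. Elementary estimates used in the proof of
Corollary 4.10 of Nesterenko–Philippon (eds.), LNM 1752 (2001), Ch. 3 §4 (p. 40), for the objects of
`NesterenkoElimination.lean` (`maxNorm` = Definition 4.1, `kappa` = `ϰ` of Definition 4.6):
`l1Norm P = ∑_γ |a_γ|` (subadditive, submultiplicative, `|P| ≤ ‖P‖₁ ≤ #supp P · |P|`); the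
telescoping estimate `l1Norm_prod_sub_prod_le` for `∏ aᵢ − ∏ bᵢ`; the linear forms
`lam ω i j = (S⁽ⁱ⁾ω̄)ⱼ = ∑ₖ s⁽ⁱ⁾_{jk} ωₖ` substituted for `u_{ij}` by `ϰ` (`‖·‖₁ ≤ (m+1)|ω̄|`, additive
in `ω̄`); and, for `F ∈ ℚ[u₁,…,u_r]` all of whose monomials have total degree `D`, the bounds
`‖ϰ_ω̄(F)‖₁ ≤ #supp F · |F| · ((m+1)|ω̄|)^D` (`l1Norm_kappa_le`) and
`‖ϰ_ω̄(F) − ϰ_β̄(F)‖₁ ≤ #supp F · |F| · D (m+1)|ω̄ − β̄| ((m+1) max(|ω̄|,|β̄|))^{D−1}`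
(`l1Norm_kappa_sub_kappa_le`); finally `|φᵢψⱼ − φⱼψᵢ| ≤ ‖φ̄ − ψ̄‖ |φ̄| |ψ̄|` and attainment of the
sup norm. Folklore bookkeeping; nothing is cited beyond the definitions it serves.

## References

* [NesterenkoPhilippon2001] Yu. V. Nesterenko, P. Philippon (eds.), *Introduction to Algebraic
  Independence Theory*, LNM 1752, Springer 2001, Ch. 3 §4, Definitions 4.1, 4.6, Cor. 4.10 (p. 37–40).
-/

noncomputable section

open MvPolynomial
open scoped NNReal

namespace Literature.NumberTheory.Transcendental

namespace Nesterenko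

/-! ### The `ℓ¹`-norm of the coefficients -/

/-- The `ℓ¹`-norm `‖P‖₁ = ∑_γ |a_γ|` of the coefficients of a polynomial over a normed field (a
submultiplicative companion of `|P| = max_γ |a_γ|` of Definition 4.1). [folklore] -/
def l1Norm {σ K : Type*} [NormedField K] (P : MvPolynomial σ K) : ℝ :=
  ∑ γ ∈ P.support, ‖P.coeff γ‖

section L1

variable {σ K : Type*} [NormedField K]

/-- `‖P‖₁ ≥ 0`. [folklore] -/
theorem l1Norm_nonneg (P : MvPolynomial σ K) : 0 ≤ l1Norm P :=
  Finset.sum_nonneg fun _ _ => norm_nonneg _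

/-- `‖P‖₁` may be computed over any finite set of exponents containing the support. [folklore] -/
theorem l1Norm_eq_sum_of_subset (P : MvPolynomial σ K) {s : Finset (σ →₀ ℕ)}
    (h : P.support ⊆ s) : l1Norm P = ∑ γ ∈ s, ‖P.coeff γ‖ := by
  unfold l1Norm
  refine Finset.sum_subset h fun γ _ hγ => ?_
  rw [MvPolynomial.notMem_support_iff.mp hγ, norm_zero]

/-- `‖0‖₁ = 0`. [folklore] -/
@[simp] theorem l1Norm_zero : l1Norm (0 : MvPolynomial σ K) = 0 := by
  simp [l1Norm]

/-- `‖a U^γ‖₁ = |a|`. [folklore] -/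
theorem l1Norm_monomial (γ : σ →₀ ℕ) (c : K) : l1Norm (monomial γ c) = ‖c‖ := by
  classical
  rw [l1Norm_eq_sum_of_subset _ support_monomial_subset, Finset.sum_singleton, coeff_monomial,
    if_pos rfl]

/-- `‖C c‖₁ = |c|`. [folklore] -/
theorem l1Norm_C (c : K) : l1Norm (C c : MvPolynomial σ K) = ‖c‖ := by
  rw [C_apply, l1Norm_monomial]

/-- `‖1‖₁ = 1`. [folklore] -/
theorem l1Norm_one : l1Norm (1 : MvPolynomial σ K) = 1 := by
  rw [← C_1, l1Norm_C, norm_one]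

/-- `‖X_v‖₁ = 1`. [folklore] -/
theorem l1Norm_X (v : σ) : l1Norm (X v : MvPolynomial σ K) = 1 := by
  rw [X, l1Norm_monomial, norm_one]

/-- `‖P + Q‖₁ ≤ ‖P‖₁ + ‖Q‖₁`. [folklore] -/
theorem l1Norm_add_le (P Q : MvPolynomial σ K) : l1Norm (P + Q) ≤ l1Norm P + l1Norm Q := by
  classical
  rw [l1Norm_eq_sum_of_subset (P + Q) support_add,
    l1Norm_eq_sum_of_subset P Finset.subset_union_left,
    l1Norm_eq_sum_of_subset Q Finset.subset_union_right, ← Finset.sum_add_distrib]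
  exact Finset.sum_le_sum fun γ _ => by rw [coeff_add]; exact norm_add_le _ _

/-- `‖−P‖₁ = ‖P‖₁`. [folklore] -/
theorem l1Norm_neg (P : MvPolynomial σ K) : l1Norm (-P) = l1Norm P := by
  unfold l1Norm
  rw [support_neg]
  simp only [coeff_neg, norm_neg]

/-- `‖P − Q‖₁ ≤ ‖P‖₁ + ‖Q‖₁`. [folklore] -/
theorem l1Norm_sub_le (P Q : MvPolynomial σ K) : l1Norm (P - Q) ≤ l1Norm P + l1Norm Q := by
  rw [sub_eq_add_neg, ← l1Norm_neg Q]
  exact l1Norm_add_le _ _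

/-- `‖∑ fᵢ‖₁ ≤ ∑ ‖fᵢ‖₁`. [folklore] -/
theorem l1Norm_sum_le {ι : Type*} (s : Finset ι) (f : ι → MvPolynomial σ K) :
    l1Norm (∑ i ∈ s, f i) ≤ ∑ i ∈ s, l1Norm (f i) :=
  Finset.le_sum_of_subadditive l1Norm l1Norm_zero.le l1Norm_add_le s f

/-- Submultiplicativity: `‖P Q‖₁ ≤ ‖P‖₁ ‖Q‖₁`. [folklore] -/
theorem l1Norm_mul_le (P Q : MvPolynomial σ K) : l1Norm (P * Q) ≤ l1Norm P * l1Norm Q := by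
  classical
  have hPQ : P * Q = ∑ α ∈ P.support, ∑ β ∈ Q.support,
      monomial (α + β) (P.coeff α * Q.coeff β) := by
    conv_lhs => rw [P.as_sum, Q.as_sum, Finset.sum_mul_sum]
    refine Finset.sum_congr rfl fun α _ => Finset.sum_congr rfl fun β _ => ?_
    rw [monomial_mul]
  calc l1Norm (P * Q)
      ≤ ∑ α ∈ P.support, ∑ β ∈ Q.support, ‖P.coeff α * Q.coeff β‖ := by
        rw [hPQ]
        refine (l1Norm_sum_le _ _).trans (Finset.sum_le_sum fun α _ => ?_)
        refine (l1Norm_sum_le _ _).trans (Finset.sum_le_sum fun β _ => ?_)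
        rw [l1Norm_monomial]
    _ = l1Norm P * l1Norm Q := by
        rw [l1Norm, l1Norm, Finset.sum_mul_sum]
        refine Finset.sum_congr rfl fun α _ => Finset.sum_congr rfl fun β _ => ?_
        rw [norm_mul]

/-- `‖∏ fᵢ‖₁ ≤ ∏ ‖fᵢ‖₁`. [folklore] -/
theorem l1Norm_prod_le {ι : Type*} (s : Finset ι) (f : ι → MvPolynomial σ K) :
    l1Norm (∏ i ∈ s, f i) ≤ ∏ i ∈ s, l1Norm (f i) := by
  classical
  induction s using Finset.induction_on with
  | empty => simp [l1Norm_one]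
  | insert a s ha ih =>
    rw [Finset.prod_insert ha, Finset.prod_insert ha]
    exact (l1Norm_mul_le _ _).trans (mul_le_mul_of_nonneg_left ih (l1Norm_nonneg _))

/-- `‖P^n‖₁ ≤ ‖P‖₁^n`. [folklore] -/
theorem l1Norm_pow_le (P : MvPolynomial σ K) (n : ℕ) : l1Norm (P ^ n) ≤ l1Norm P ^ n := by
  induction n with
  | zero => simp [l1Norm_one]
  | succ n ih =>
    rw [pow_succ, pow_succ]
    exact (l1Norm_mul_le _ _).trans (mul_le_mul_of_nonneg_right ih (l1Norm_nonneg _))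

/-- `|P| ≤ ‖P‖₁`. [folklore] -/
theorem maxNorm_le_l1Norm (P : MvPolynomial σ K) : maxNorm P ≤ l1Norm P := by
  unfold maxNorm
  rw [← Real.coe_toNNReal (l1Norm P) (l1Norm_nonneg P), NNReal.coe_le_coe]
  refine Finset.sup_le fun γ hγ => ?_
  rw [← NNReal.coe_le_coe, coe_nnnorm, Real.coe_toNNReal _ (l1Norm_nonneg P)]
  exact Finset.single_le_sum (f := fun γ => ‖P.coeff γ‖) (fun _ _ => norm_nonneg _) hγ

/-- `‖P‖₁ ≤ #supp P · |P|`. [folklore] -/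
theorem l1Norm_le_card_mul_maxNorm (P : MvPolynomial σ K) :
    l1Norm P ≤ P.support.card * maxNorm P := by
  unfold l1Norm
  calc ∑ γ ∈ P.support, ‖P.coeff γ‖ ≤ ∑ γ ∈ P.support, maxNorm P :=
        Finset.sum_le_sum fun γ _ => norm_coeff_le_maxNorm P γ
    _ = P.support.card * maxNorm P := by rw [Finset.sum_const, nsmul_eq_mul]

/-- `|P| > 0` for `P ≠ 0`. [folklore] -/
theorem maxNorm_pos {P : MvPolynomial σ K} (h : P ≠ 0) : 0 < maxNorm P := by
  obtain ⟨γ, hγ⟩ := MvPolynomial.ne_zero_iff.mp h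
  exact (norm_pos_iff.mpr hγ).trans_le (norm_coeff_le_maxNorm P γ)

/-- Telescoping estimate: if `‖aᵢ‖₁, ‖bᵢ‖₁ ≤ A^{nᵢ}` and `‖aᵢ − bᵢ‖₁ ≤ nᵢ ε A^{nᵢ−1}`, then
`‖∏ aᵢ − ∏ bᵢ‖₁ ≤ (∑ nᵢ) ε A^{∑ nᵢ − 1}`. [folklore] -/
theorem l1Norm_prod_sub_prod_le {ι : Type*} (s : Finset ι) (a b : ι → MvPolynomial σ K)
    (n : ι → ℕ) {A ε : ℝ} (hA : 0 ≤ A) (hε : 0 ≤ ε)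
    (ha : ∀ i ∈ s, l1Norm (a i) ≤ A ^ n i) (hb : ∀ i ∈ s, l1Norm (b i) ≤ A ^ n i)
    (hab : ∀ i ∈ s, l1Norm (a i - b i) ≤ n i * ε * A ^ (n i - 1)) :
    l1Norm (∏ i ∈ s, a i - ∏ i ∈ s, b i) ≤
      (∑ i ∈ s, n i : ℕ) * ε * A ^ ((∑ i ∈ s, n i) - 1) := by
  classical
  induction s using Finset.induction_on with
  | empty => simp
  | insert t s ht ih =>
    have ha' : ∀ i ∈ s, l1Norm (a i) ≤ A ^ n i := fun i hi => ha i (Finset.mem_insert_of_mem hi)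
    have hb' : ∀ i ∈ s, l1Norm (b i) ≤ A ^ n i := fun i hi => hb i (Finset.mem_insert_of_mem hi)
    have hab' : ∀ i ∈ s, l1Norm (a i - b i) ≤ n i * ε * A ^ (n i - 1) := fun i hi =>
      hab i (Finset.mem_insert_of_mem hi)
    have ih' := ih ha' hb' hab'
    rw [Finset.prod_insert ht, Finset.prod_insert ht, Finset.sum_insert ht]
    set N := ∑ i ∈ s, n i with hNdef
    have hprodb : l1Norm (∏ i ∈ s, b i) ≤ A ^ N := by
      calc l1Norm (∏ i ∈ s, b i) ≤ ∏ i ∈ s, l1Norm (b i) := l1Norm_prod_le _ _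
        _ ≤ ∏ i ∈ s, A ^ n i := Finset.prod_le_prod (fun i _ => l1Norm_nonneg _) hb'
        _ = A ^ N := Finset.prod_pow_eq_pow_sum s n A
    have key : a t * ∏ i ∈ s, a i - b t * ∏ i ∈ s, b i =
        a t * (∏ i ∈ s, a i - ∏ i ∈ s, b i) + (a t - b t) * ∏ i ∈ s, b i := by ring
    have h1 : A ^ n t * ((N : ℝ) * ε * A ^ (N - 1)) ≤ N * ε * A ^ (n t + N - 1) := by
      rcases Nat.eq_zero_or_pos N with hN | hN
      · simp [hN]
      · rw [show n t + N - 1 = n t + (N - 1) by omega, pow_add]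
        exact le_of_eq (by ring)
    have h2 : (n t : ℝ) * ε * A ^ (n t - 1) * A ^ N ≤ n t * ε * A ^ (n t + N - 1) := by
      rcases Nat.eq_zero_or_pos (n t) with hn | hn
      · simp [hn]
      · rw [show n t + N - 1 = (n t - 1) + N by omega, pow_add]
        exact le_of_eq (by ring)
    rw [key]
    calc l1Norm (a t * (∏ i ∈ s, a i - ∏ i ∈ s, b i) + (a t - b t) * ∏ i ∈ s, b i)
        ≤ l1Norm (a t) * l1Norm (∏ i ∈ s, a i - ∏ i ∈ s, b i) +
            l1Norm (a t - b t) * l1Norm (∏ i ∈ s, b i) :=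
          (l1Norm_add_le _ _).trans (add_le_add (l1Norm_mul_le _ _) (l1Norm_mul_le _ _))
      _ ≤ A ^ n t * ((N : ℝ) * ε * A ^ (N - 1)) + (n t * ε * A ^ (n t - 1)) * A ^ N :=
          add_le_add
            (mul_le_mul (ha t (Finset.mem_insert_self t s)) ih' (l1Norm_nonneg _)
              (pow_nonneg hA _))
            (mul_le_mul (hab t (Finset.mem_insert_self t s)) hprodb (l1Norm_nonneg _)
              (mul_nonneg (mul_nonneg (Nat.cast_nonneg _) hε) (pow_nonneg hA _)))
      _ ≤ N * ε * A ^ (n t + N - 1) + n t * ε * A ^ (n t + N - 1) := add_le_add h1 h2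
      _ = ((n t + N : ℕ) : ℝ) * ε * A ^ (n t + N - 1) := by push_cast; ring

end L1

/-! ### The linear forms `(S⁽ⁱ⁾ω̄)ⱼ` and the two bounds on `ϰ` -/

variable {m r : ℕ}

/-- `λ_{ij}(ω̄) = (S⁽ⁱ⁾ω̄)ⱼ = ∑ₖ s⁽ⁱ⁾_{jk} ωₖ`, the linear form in the skew variables that `ϰ`
substitutes for `u_{ij}` (Definition 4.6). [cite: NesterenkoPhilippon2001, Ch. 3 Def. 4.6 (p. 39)] -/
def lam (ω : Fin (m + 1) → ℂ) (i : Fin r) (j : Fin (m + 1)) : RS r m :=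
  ∑ k : Fin (m + 1), skewEntry i j k * C (ω k)

/-- `ϰ_ω̄` is the substitution `u_{ij} ↦ λ_{ij}(ω̄)` (definitional unfolding of `kappa`).
[cite: NesterenkoPhilippon2001, Ch. 3 Def. 4.6 (p. 39)] -/
theorem kappa_eq_aeval_lam (ω : Fin (m + 1) → ℂ) (F : RU r m) :
    kappa ω F = aeval (fun ij : Fin r × Fin (m + 1) => lam ω ij.1 ij.2) F :=
  rfl

/-- `λ_{ij}` is additive in `ω̄`: `λ_{ij}(ω̄) − λ_{ij}(β̄) = λ_{ij}(ω̄ − β̄)`. [folklore] -/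
theorem lam_sub (ω β : Fin (m + 1) → ℂ) (i : Fin r) (j : Fin (m + 1)) :
    lam ω i j - lam β i j = lam (ω - β) i j := by
  simp only [lam, ← Finset.sum_sub_distrib, Pi.sub_apply, map_sub, mul_sub]

/-- `λ_{ij}(c ω̄) = c λ_{ij}(ω̄)`. [folklore] -/
theorem lam_smul (c : ℂ) (ω : Fin (m + 1) → ℂ) (i : Fin r) (j : Fin (m + 1)) :
    lam (c • ω) i j = C c * lam ω i j := by
  simp only [lam, Pi.smul_apply, smul_eq_mul, map_mul, Finset.mul_sum]
  refine Finset.sum_congr rfl fun k _ => ?_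
  ring

/-- `‖s⁽ⁱ⁾_{jk}‖₁ ≤ 1`. [folklore] -/
theorem l1Norm_skewEntry_le (i : Fin r) (j k : Fin (m + 1)) :
    l1Norm (skewEntry (m := m) i j k) ≤ 1 := by
  unfold skewEntry
  split_ifs
  · rw [l1Norm_X]
  · rw [l1Norm_neg, l1Norm_X]
  · rw [l1Norm_zero]; exact zero_le_one

/-- `‖λ_{ij}(ω̄)‖₁ ≤ (m+1)|ω̄|`. [folklore] -/
theorem l1Norm_lam_le (ω : Fin (m + 1) → ℂ) (i : Fin r) (j : Fin (m + 1)) :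
    l1Norm (lam ω i j) ≤ (m + 1) * ‖ω‖ := by
  unfold lam
  calc l1Norm (∑ k, skewEntry i j k * C (ω k))
      ≤ ∑ k : Fin (m + 1), l1Norm (skewEntry i j k * C (ω k)) := l1Norm_sum_le _ _
    _ ≤ ∑ _k : Fin (m + 1), ‖ω‖ := Finset.sum_le_sum fun k _ => by
        calc l1Norm (skewEntry i j k * C (ω k))
            ≤ l1Norm (skewEntry i j k) * l1Norm (C (ω k) : RS r m) := l1Norm_mul_le _ _
          _ ≤ 1 * ‖ω k‖ := by
              rw [l1Norm_C]
              exact mul_le_mul_of_nonneg_right (l1Norm_skewEntry_le i j k) (norm_nonneg _)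
          _ ≤ ‖ω‖ := by rw [one_mul]; exact norm_le_pi_norm ω k
    _ = (m + 1) * ‖ω‖ := by
        rw [Finset.sum_const, Finset.card_univ, Fintype.card_fin, nsmul_eq_mul, Nat.cast_add,
          Nat.cast_one]

/-- `‖∏ λ_v(ω̄)^{γ_v}‖₁ ≤ ((m+1)|ω̄|)^{|γ|}`. [folklore] -/
theorem l1Norm_prod_lam_pow_le (ω : Fin (m + 1) → ℂ) (γ : Fin r × Fin (m + 1) →₀ ℕ) :
    l1Norm (γ.prod fun v e => lam ω v.1 v.2 ^ e) ≤ ((m + 1) * ‖ω‖) ^ γ.degree := by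
  rw [Finsupp.prod, Finsupp.degree_apply, ← Finset.prod_pow_eq_pow_sum]
  refine (l1Norm_prod_le _ _).trans (Finset.prod_le_prod (fun v _ => l1Norm_nonneg _) fun v _ => ?_)
  exact (l1Norm_pow_le _ _).trans (pow_le_pow_left₀ (l1Norm_nonneg _) (l1Norm_lam_le ω v.1 v.2) _)

/-- The telescoping bound for one monomial:
`‖∏ λ_v(ω̄)^{γ_v} − ∏ λ_v(β̄)^{γ_v}‖₁ ≤ |γ| (m+1)|ω̄ − β̄| ((m+1) max(|ω̄|,|β̄|))^{|γ|−1}`. [folklore] -/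
theorem l1Norm_prod_lam_pow_sub_le (ω β : Fin (m + 1) → ℂ) (γ : Fin r × Fin (m + 1) →₀ ℕ) :
    l1Norm ((γ.prod fun v e => lam ω v.1 v.2 ^ e) - γ.prod fun v e => lam β v.1 v.2 ^ e) ≤
      γ.degree * ((m + 1) * ‖ω - β‖) * ((m + 1) * max ‖ω‖ ‖β‖) ^ (γ.degree - 1) := by
  set A : ℝ := (m + 1) * max ‖ω‖ ‖β‖ with hAdef
  set ε : ℝ := (m + 1) * ‖ω - β‖ with hεdef
  have hA : 0 ≤ A := by positivity
  have hε : 0 ≤ ε := by positivity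
  have hωA : ∀ v : Fin r × Fin (m + 1), l1Norm (lam ω v.1 v.2) ≤ A := fun v =>
    (l1Norm_lam_le ω v.1 v.2).trans (by rw [hAdef]; gcongr; exact le_max_left _ _)
  have hβA : ∀ v : Fin r × Fin (m + 1), l1Norm (lam β v.1 v.2) ≤ A := fun v =>
    (l1Norm_lam_le β v.1 v.2).trans (by rw [hAdef]; gcongr; exact le_max_right _ _)
  have hdiff : ∀ v : Fin r × Fin (m + 1), l1Norm (lam ω v.1 v.2 - lam β v.1 v.2) ≤ ε := fun v => by
    rw [lam_sub]; exact l1Norm_lam_le _ _ _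
  have hpow : ∀ (v : Fin r × Fin (m + 1)) (k : ℕ),
      l1Norm (lam ω v.1 v.2 ^ k - lam β v.1 v.2 ^ k) ≤ k * ε * A ^ (k - 1) := by
    intro v k
    have h := l1Norm_prod_sub_prod_le (Finset.range k) (fun _ => lam ω v.1 v.2)
      (fun _ => lam β v.1 v.2) (fun _ => 1) hA hε (fun _ _ => by simpa using hωA v)
      (fun _ _ => by simpa using hβA v) (fun _ _ => by simpa using hdiff v)
    simpa [Finset.prod_const, Finset.card_range] using h
  rw [Finsupp.prod, Finsupp.prod, Finsupp.degree_apply]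
  exact l1Norm_prod_sub_prod_le γ.support _ _ (fun v => γ v) hA hε
    (fun v _ => (l1Norm_pow_le _ _).trans (pow_le_pow_left₀ (l1Norm_nonneg _) (hωA v) _))
    (fun v _ => (l1Norm_pow_le _ _).trans (pow_le_pow_left₀ (l1Norm_nonneg _) (hβA v) _))
    (fun v _ => hpow v (γ v))

/-- Expansion of `ϰ_ω̄(F)` along the monomials of `F`. [folklore] -/
theorem kappa_eq_sum (ω : Fin (m + 1) → ℂ) (F : RU r m) :
    kappa ω F = ∑ γ ∈ F.support,
      C ((F.coeff γ : ℚ) : ℂ) * γ.prod fun v e => lam ω v.1 v.2 ^ e := by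
  conv_lhs => rw [kappa_eq_aeval_lam, F.as_sum, map_sum]
  refine Finset.sum_congr rfl fun γ _ => ?_
  rw [aeval_monomial, MvPolynomial.algebraMap_apply, eq_ratCast]

/-- `ϰ` of a constant is that constant. [folklore] -/
theorem kappa_C (ω : Fin (m + 1) → ℂ) (a : ℚ) : kappa (r := r) ω (C a) = C (a : ℂ) := by
  rw [kappa_eq_aeval_lam, algHom_C, MvPolynomial.algebraMap_apply, eq_ratCast]

/-- The absolute value of a rational coefficient, seen in `ℂ`, is bounded by `|F|`. [folklore] -/
theorem norm_ratCast_coeff_le_maxNorm (F : RU r m) (γ : Fin r × Fin (m + 1) →₀ ℕ) :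
    ‖((F.coeff γ : ℚ) : ℂ)‖ ≤ maxNorm F := by
  have h := norm_coeff_le_maxNorm F γ
  rwa [← Rat.norm_cast_real, Real.norm_eq_abs, ← Complex.norm_ratCast] at h

/-- **Trivial bound.** If every monomial of `F` has total degree `D`, then
`‖ϰ_ω̄(F)‖₁ ≤ #supp F · |F| · ((m+1)|ω̄|)^D`. [folklore] -/
theorem l1Norm_kappa_le (ω : Fin (m + 1) → ℂ) (F : RU r m) (D : ℕ)
    (hF : ∀ γ ∈ F.support, γ.degree = D) :
    l1Norm (kappa ω F) ≤ F.support.card * maxNorm F * ((m + 1) * ‖ω‖) ^ D := by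
  rw [kappa_eq_sum]
  calc l1Norm (∑ γ ∈ F.support, C ((F.coeff γ : ℚ) : ℂ) * γ.prod fun v e => lam ω v.1 v.2 ^ e)
      ≤ ∑ γ ∈ F.support, l1Norm (C ((F.coeff γ : ℚ) : ℂ) * γ.prod fun v e => lam ω v.1 v.2 ^ e) :=
        l1Norm_sum_le _ _
    _ ≤ ∑ _γ ∈ F.support, maxNorm F * ((m + 1) * ‖ω‖) ^ D := Finset.sum_le_sum fun γ hγ => by
        refine (l1Norm_mul_le _ _).trans ?_
        rw [l1Norm_C, ← hF γ hγ]
        exact mul_le_mul (norm_ratCast_coeff_le_maxNorm F γ) (l1Norm_prod_lam_pow_le ω γ)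
          (l1Norm_nonneg _) (maxNorm_nonneg _)
    _ = F.support.card * maxNorm F * ((m + 1) * ‖ω‖) ^ D := by
        rw [Finset.sum_const, nsmul_eq_mul]
        ring

/-- **Difference bound.** If every monomial of `F` has total degree `D`, then
`‖ϰ_ω̄(F) − ϰ_β̄(F)‖₁ ≤ #supp F · |F| · D (m+1)|ω̄ − β̄| ((m+1) max(|ω̄|, |β̄|))^{D−1}`. [folklore] -/
theorem l1Norm_kappa_sub_kappa_le (ω β : Fin (m + 1) → ℂ) (F : RU r m) (D : ℕ)
    (hF : ∀ γ ∈ F.support, γ.degree = D) :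
    l1Norm (kappa ω F - kappa β F) ≤ F.support.card * maxNorm F *
      (D * ((m + 1) * ‖ω - β‖) * ((m + 1) * max ‖ω‖ ‖β‖) ^ (D - 1)) := by
  have hexp : kappa ω F - kappa β F = ∑ γ ∈ F.support, C ((F.coeff γ : ℚ) : ℂ) *
      ((γ.prod fun v e => lam ω v.1 v.2 ^ e) - γ.prod fun v e => lam β v.1 v.2 ^ e) := by
    rw [kappa_eq_sum, kappa_eq_sum, ← Finset.sum_sub_distrib]
    refine Finset.sum_congr rfl fun γ _ => ?_
    rw [mul_sub]
  rw [hexp]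
  calc l1Norm (∑ γ ∈ F.support, C ((F.coeff γ : ℚ) : ℂ) *
        ((γ.prod fun v e => lam ω v.1 v.2 ^ e) - γ.prod fun v e => lam β v.1 v.2 ^ e))
      ≤ ∑ γ ∈ F.support, l1Norm (C ((F.coeff γ : ℚ) : ℂ) *
          ((γ.prod fun v e => lam ω v.1 v.2 ^ e) - γ.prod fun v e => lam β v.1 v.2 ^ e)) :=
        l1Norm_sum_le _ _
    _ ≤ ∑ _γ ∈ F.support, maxNorm F *
          (D * ((m + 1) * ‖ω - β‖) * ((m + 1) * max ‖ω‖ ‖β‖) ^ (D - 1)) :=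
        Finset.sum_le_sum fun γ hγ => by
          refine (l1Norm_mul_le _ _).trans ?_
          rw [l1Norm_C, ← hF γ hγ]
          exact mul_le_mul (norm_ratCast_coeff_le_maxNorm F γ) (l1Norm_prod_lam_pow_sub_le ω β γ)
            (l1Norm_nonneg _) (maxNorm_nonneg _)
    _ = F.support.card * maxNorm F *
          (D * ((m + 1) * ‖ω - β‖) * ((m + 1) * max ‖ω‖ ‖β‖) ^ (D - 1)) := by
        rw [Finset.sum_const, nsmul_eq_mul]
        ring

/-! ### Two small facts about the projective distance -/

/-- Every `2 × 2` minor is bounded by the projective distance: `|φᵢψⱼ − φⱼψᵢ| ≤ ‖φ̄ − ψ̄‖ |φ̄| |ψ̄|`.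
[folklore] -/
theorem norm_minor_le_projDist_mul (φ ψ : Fin (m + 1) → ℂ) (i j : Fin (m + 1)) :
    ‖φ i * ψ j - φ j * ψ i‖ ≤ projDist φ ψ * (‖φ‖ * ‖ψ‖) := by
  by_cases hφ : φ = 0
  · simp [hφ]
  by_cases hψ : ψ = 0
  · simp [hψ]
  have hpos : 0 < ‖φ‖ * ‖ψ‖ := mul_pos (norm_pos_iff.mpr hφ) (norm_pos_iff.mpr hψ)
  rw [projDist, div_mul_cancel₀ _ hpos.ne']
  rcases lt_trichotomy i j with h | rfl | h
  · have hle : ‖φ i * ψ j - φ j * ψ i‖₊ ≤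
        Finset.univ.sup fun p : SkewIdx m => ‖φ p.1.1 * ψ p.1.2 - φ p.1.2 * ψ p.1.1‖₊ :=
      Finset.le_sup (f := fun p : SkewIdx m => ‖φ p.1.1 * ψ p.1.2 - φ p.1.2 * ψ p.1.1‖₊)
        (Finset.mem_univ (⟨(i, j), h⟩ : SkewIdx m))
    exact_mod_cast hle
  · simp
  · have hle : ‖φ j * ψ i - φ i * ψ j‖₊ ≤
        Finset.univ.sup fun p : SkewIdx m => ‖φ p.1.1 * ψ p.1.2 - φ p.1.2 * ψ p.1.1‖₊ :=
      Finset.le_sup (f := fun p : SkewIdx m => ‖φ p.1.1 * ψ p.1.2 - φ p.1.2 * ψ p.1.1‖₊)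
        (Finset.mem_univ (⟨(j, i), h⟩ : SkewIdx m))
    rw [← norm_neg, neg_sub]
    exact_mod_cast hle

/-- The sup norm `|ω̄| = max |ωⱼ|` is attained. [folklore] -/
theorem exists_norm_apply_eq_norm (ω : Fin (m + 1) → ℂ) : ∃ j, ‖ω j‖ = ‖ω‖ := by
  obtain ⟨j, -, hj⟩ :=
    Finset.exists_mem_eq_sup Finset.univ Finset.univ_nonempty fun b => ‖ω b‖₊
  exact ⟨j, by rw [← coe_nnnorm, ← coe_nnnorm, Pi.nnnorm_def, hj]⟩

end Nesterenko

end Literature.NumberTheory.Transcendental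

end
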